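import Literature.NumberTheory.EllipticCurves.TunnellThetaCuspExpansionProofs
import Literature.NumberTheory.EllipticCurves.TunnellThetaAutomorphyProofs
import Literature.NumberTheory.EllipticCurves.TunnellFormsAutomorphy
import Literature.NumberTheory.EllipticCurves.HalfIntegralWeightGaussSumsTwo
import HarnessLib

/-!
# Tunnell's forms `g θ_t` are cusp forms: `g θ₂, g θ₈, g θ₃₂ ∈ S_{3/2}(128, 1)` and
# `g θ₁, g θ₄, g θ₁₆ ∈ S_{3/2}(128, χ₂)` (Tunnell 1983, p. 327)

Third and last step of the membership proof (after `TunnellThetaAutomorphyProofs` — automorphy —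
and `TunnellThetaCuspExpansionProofs` — the expansion of `θ_s(gz)` at an arbitrary cusp): the cusp
condition of `halfIntCuspForms 3 128 χ`, i.e. `slashSq 3 (g θ_t) g → 0` at `i∞` for EVERY
`g ∈ SL₂(ℤ)`, and the resulting memberships. Tunnell, p. 327: "By Theorem 1 and the previous
remarks, a basis for the space of cusp forms of weight `3/2`, level `128` and trivial character is
`{g θ₂, g θ₈, g θ₃₂}`. Similarly, `{g θ₁, g θ₄, g θ₁₆}` is a basis for the weight `3/2` cusp forms of
level `128` and character `χ₈`" — we PROVE the membership half of these two sentences: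

* `tunnellForm_two/eight/thirtytwo_mem_halfIntCuspForms` — `g θ₂, g θ₈, g θ₃₂ ∈ S_{3/2}(128, 1)`;
* `tunnellForm_one/four/sixteen_mem_halfIntCuspForms` — `g θ₁, g θ₄, g θ₁₆ ∈ S_{3/2}(128, χ₂)`;

and record the consequences for the named facts of `TunnellHalfIntegralForms`:

* `Tunnell1983_thm2_triv_iff_isAlmostEigenform`, `Tunnell1983_thm2_chi2_iff_isAlmostEigenform` —
  **Theorem 2 is reduced to its Hecke half**: `Tunnell1983_thm2_triv ↔ (g θ₂, g θ₈ are
  T(p²)-eigenforms with eigenvalues a_p(E) for almost all p)` (`IsAlmostEigenform`), the part of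
  Theorem 2 resting on `dim S_{3/2}(128, ·) = 3` [Cohen–Oesterlé], the stability under `T(p²)`
  [Shimura 1973, Thm 1.7] and Shimura's correspondence (pp. 327–328), which remains open here;
* `Tunnell1983_waldspurger_triv_iff_propto`, `Tunnell1983_waldspurger_chi2_iff_propto` — with (M)
  proved, the leaves "Waldspurger's theorem as applied on p. 329" are EXACTLY the two displays of
  p. 329 (`Tunnell1983_a/b_sq_propto_L_one`), by `Tunnell1983_waldspurger_triv/chi2_iff`.

## Proof of the cusp condition

Let `F = g θ_t`, `2F = (θ₁ - θ₄)(2θ₃₂ - θ₈) θ_t` (`two_mul_tunnellForm_eq`), `g = (a b; c d)`.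

* `c > 0` (`isZeroAtImInfty_slashSq_tunnellForm_of_pos`). With the common prefactor
  `P(z) = (2i/(cz + d))^{-1/2}` one has `P(z)²/(cz + d) = 1/(2i)` and, for every `s ≥ 1`,
  `θ_s(gz)/P(z) → L_s := G(aδ; c'')/√(c''δ)` (`tendsto_thetaMul_div_prefactor`, `α = gcd(s, c)`,
  `s = αδ`, `c = αc''`). Hence `F(gz)²/(cz + d)³ = ¼ (2i)⁻³ (ABC)²` with `A = (θ₁ - θ₄)(gz)/P`,
  `B = (2θ₃₂ - θ₈)(gz)/P`, `C = θ_t(gz)/P`, and it suffices that `lim A · lim B = 0`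
  (`tendsto_weightOneFactor`, i.e. **the weight-`1` form `2g = (θ₁ - θ₄)(2θ₃₂ - θ₈)` vanishes at every
  cusp**, Tunnell's Thm 1):
  - if `16 ∣ c`: `L₁ = G(a; c)/√c` and `L₄ = G(a; c/4)/√(c/4)` (`α = 4`, `δ = 1`) agree, because
    `G(a; c) = 2 G(a; c/4)` for `4 ∣ c/4`, `a` odd (`quadGaussSum_four_mul'`) — so `lim A = 0`
    (`tendsto_thetaMul_one_sub_four`);
  - if `16 ∤ c`: `gcd(32, c) = gcd(8, c) = α` and `c'' = c/α` is odd (`gcd_thirtytwo_eq_gcd_eight`,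
    `odd_div_gcd_eight`), so with `δ = 8/α`: `L₈ = G(aδ; c'')/√(c''δ)`,
    `L₃₂ = G(4aδ; c'')/√(4c''δ) = ½ L₈` (`G(4x; c'') = G(x; c'')` for odd `c''`,
    `quadGaussSum_four_mul_left`) — so `lim B = 2L₃₂ - L₈ = 0`
    (`tendsto_two_mul_thetaMul_thirtytwo_sub_eight`).
* `c < 0`: `slashSq 3 F g = -slashSq 3 F (-g)` (`isZeroAtImInfty_slashSq_tunnellForm_of_neg`).
* `c = 0`: `gz = z + n`, `F(z + n) = F(z)`, `d = ±1`, so `slashSq 3 F g = ±F²`; and `F² → 0` at `i∞`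
  because `F(z)² = slashSq 3 F W z` for `W = (1 0; 128 1)` by the automorphy
  `F(Wz) = j(W, z)³ F(z)`, `j(W, z)² = 128z + 1` (`isZeroAtImInfty_tunnellForm_sq`; this step uses
  `4t ∣ 128`).

Together with `mdifferentiable_tunnellForm` and `isThetaAutomorphic_tunnellForm_*` this gives the
six memberships. No statement of the tree is used unproved.

## References

* J. B. Tunnell, *A classical Diophantine problem and modular forms of weight 3/2*, Invent. Math.
  72 (1983) 323–334: Thm 1 (p. 326, `g ∈ S₁(128, χ₋₂)`), p. 327 ll. 13–20 (the forms `g θ_t`, the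
  two bases), Thm 2 (pp. 327–328), proof of Thm 3 (p. 329). [Tunnell1983Congruent]
* G. Shimura, *On modular forms of half integral weight*, Ann. of Math. 97 (1973) 440–481, §1–§2.
  [Shimura1973HalfIntegral]
* N. Koblitz, *Introduction to Elliptic Curves and Modular Forms*, GTM 97, Ch. IV §1 (cusp
  conditions for half-integral weight; `θ` at the cusps of `Γ₀(4)`). [KoblitzECMF1993]
-/

noncomputable section

open scoped MatrixGroups NumberTheorySymbols

open UpperHalfPlane hiding I
open Complex Filter Topology
open scoped Real

namespace Literature.NumberTheory.EllipticCurves.Tunnell1983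

open Literature.NumberTheory.EllipticCurves.ModularForms

/-! ### Two facts about `gcd(8, c)` and `gcd(32, c)` when `16 ∤ c` -/

/-- If `16 ∤ c` then `gcd(32, c) = gcd(8, c)`. [folklore] -/
theorem gcd_thirtytwo_eq_gcd_eight {c : ℕ} (h : ¬ 16 ∣ c) : Nat.gcd 32 c = Nat.gcd 8 c := by
  apply Nat.dvd_antisymm
  · refine Nat.dvd_gcd ?_ (Nat.gcd_dvd_right 32 c)
    have h32 : Nat.gcd 32 c ∣ 2 ^ 5 := Nat.gcd_dvd_left 32 c
    obtain ⟨k, hk, hk'⟩ := (Nat.dvd_prime_pow Nat.prime_two).mp h32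
    rw [hk']
    have hk3 : k ≤ 3 := by
      by_contra hlt
      push Not at hlt
      apply h
      have : 2 ^ 4 ∣ 2 ^ k := Nat.pow_dvd_pow 2 hlt
      exact this.trans (hk' ▸ Nat.gcd_dvd_right 32 c)
    exact Nat.pow_dvd_pow 2 hk3
  · exact Nat.gcd_dvd_gcd_of_dvd_left c (by norm_num : 8 ∣ 32)

/-- If `16 ∤ c` then `c / gcd(8, c)` is odd. [folklore] -/
theorem odd_div_gcd_eight {c : ℕ} (h : ¬ 16 ∣ c) : Odd (c / Nat.gcd 8 c) := by
  have h8 : Nat.gcd 8 c ∣ 2 ^ 3 := Nat.gcd_dvd_left 8 c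
  obtain ⟨k, hk, hk'⟩ := (Nat.dvd_prime_pow Nat.prime_two).mp h8
  have hαc : Nat.gcd 8 c ∣ c := Nat.gcd_dvd_right 8 c
  rw [← Nat.not_even_iff_odd]
  rintro ⟨r, hr⟩
  have hcr : c = 2 ^ (k + 1) * r := by
    have := Nat.div_mul_cancel hαc
    rw [← this, hr, hk']
    ring
  rcases Nat.lt_or_ge k 3 with hk3 | hk3
  · -- `2^{k+1} ∣ gcd(8, c) = 2^k`: impossible
    have h1 : 2 ^ (k + 1) ∣ Nat.gcd 8 c :=
      Nat.dvd_gcd (by rw [show (8 : ℕ) = 2 ^ 3 by norm_num]; exact Nat.pow_dvd_pow 2 hk3)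
        ⟨r, hcr⟩
    rw [hk', Nat.pow_dvd_pow_iff_le_right (by norm_num)] at h1
    omega
  · -- `k = 3`: `16 ∣ c`
    have hk3' : k = 3 := le_antisymm hk hk3
    apply h
    rw [hcr, hk3']
    exact Dvd.intro r rfl

/-! ### The weight-`1` factor `(θ₁ - θ₄)(2θ₃₂ - θ₈) = 2g` vanishes at every cusp -/

section Pos

variable {c : ℕ} [NeZero c]

/-- **The first factor at the cusps with `16 ∣ c`**: the limits of `θ₁(gz)/P(z)` and
`θ₄(gz)/P(z)` coincide, `G(a; c)/√c = G(a; c/4)/√(c/4)` (`G(a; c) = 2 G(a; c/4)` as `4 ∣ c/4`).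
[folklore] -/
theorem tendsto_thetaMul_one_sub_four {g : SL(2, ℤ)} (hc : (g 1 0 : ℤ) = c) (h16 : 16 ∣ c) :
    Tendsto (fun z : ℍ ↦ (thetaMul 1 (g • z) - thetaMul 4 (g • z)) /
      (1 / (2 * I / ((c : ℂ) * z + g 1 1)) ^ (1 / 2 : ℂ))) atImInfty (𝓝 0) := by
  obtain ⟨e, he⟩ := h16
  have hcpos : 0 < c := Nat.pos_of_ne_zero (NeZero.ne c)
  have hepos : 0 < e := by
    rcases Nat.eq_zero_or_pos e with h0 | h0
    · rw [h0, mul_zero] at he; omega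
    · exact h0
  haveI : NeZero (4 * e) := ⟨by omega⟩
  -- `s = 1`: parameters `(α, δ, c'') = (1, 1, c)`
  have L1 := tendsto_thetaMul_div_prefactor hc (s := 1) (α := 1) (δ := 1) (c'' := c) one_pos
    (Nat.gcd_one_left c).symm (by norm_num) (by rw [one_mul])
  -- `s = 4`: parameters `(α, δ, c'') = (4, 1, c/4)`
  have hα4 : 4 = Nat.gcd 4 c := by
    rw [he, show 16 * e = 4 * (4 * e) by ring, Nat.gcd_mul_right_right]
  have L4 := tendsto_thetaMul_div_prefactor hc (s := 4) (α := 4) (δ := 1) (c'' := 4 * e)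
    (by norm_num) hα4 (by norm_num) (by rw [he]; ring)
  have key := L1.sub L4
  simp only [← sub_div] at key
  convert key using 2
  -- the two limits agree
  have ha : Odd (g 0 0 : ℤ) := odd_entry_of_even hc ⟨8 * e, by rw [he]; ring⟩
  have hG : quadGaussSum c (((g 0 0 : ℤ) * (1 : ℕ) : ℤ) : ZMod c) 0 =
      2 * quadGaussSum (4 * e) (((g 0 0 : ℤ) * (1 : ℕ) : ℤ) : ZMod (4 * e)) 0 := by
    have := quadGaussSum_four_mul' (c := c) (m := 4 * e) (by rw [he]; ring) ⟨e, rfl⟩ ha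
    simpa using this
  have hsqrt : Real.sqrt ((c * 1 : ℕ) : ℝ) = 2 * Real.sqrt ((4 * e * 1 : ℕ) : ℝ) := by
    rw [mul_one, mul_one, he, show ((16 * e : ℕ) : ℝ) = 4 * ((4 * e : ℕ) : ℝ) by push_cast; ring,
      Real.sqrt_mul (by norm_num : (0 : ℝ) ≤ 4), show (4 : ℝ) = 2 ^ 2 by norm_num,
      Real.sqrt_sq (by norm_num : (0 : ℝ) ≤ 2)]
  have hs0 : (Real.sqrt ((4 * e * 1 : ℕ) : ℝ) : ℂ) ≠ 0 := by
    have : (0 : ℝ) < (4 * e * 1 : ℕ) := by exact_mod_cast (by omega : 0 < 4 * e * 1)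
    exact_mod_cast (Real.sqrt_pos.mpr this).ne'
  rw [hG, hsqrt]
  push_cast
  field_simp
  ring

/-- **The second factor at the cusps with `16 ∤ c`**: the limits of `2θ₃₂(gz)/P(z)` and
`θ₈(gz)/P(z)` coincide: with `α = gcd(8, c) = gcd(32, c)`, `δ = 8/α`, `c'' = c/α` odd,
`2 G(4aδ; c'')/√(4c''δ) = G(aδ; c'')/√(c''δ)` (`G(4x; c'') = G(x; c'')` for odd `c''`). [folklore] -/
theorem tendsto_two_mul_thetaMul_thirtytwo_sub_eight {g : SL(2, ℤ)} (hc : (g 1 0 : ℤ) = c)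
    (h16 : ¬ 16 ∣ c) :
    Tendsto (fun z : ℍ ↦ (2 * thetaMul 32 (g • z) - thetaMul 8 (g • z)) /
      (1 / (2 * I / ((c : ℂ) * z + g 1 1)) ^ (1 / 2 : ℂ))) atImInfty (𝓝 0) := by
  have hcpos : 0 < c := Nat.pos_of_ne_zero (NeZero.ne c)
  set α : ℕ := Nat.gcd 8 c with hα
  set δ : ℕ := 8 / α with hδ
  set c'' : ℕ := c / α with hc''
  have hαpos : 0 < α := Nat.gcd_pos_of_pos_right _ hcpos
  have h8 : 8 = α * δ := (Nat.mul_div_cancel' (Nat.gcd_dvd_left 8 c)).symm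
  have hcc : c = α * c'' := (Nat.mul_div_cancel' (Nat.gcd_dvd_right 8 c)).symm
  have h32 : 32 = α * (4 * δ) := by
    calc (32 : ℕ) = 4 * 8 := by norm_num
      _ = α * (4 * δ) := by rw [h8]; ring
  have hα32 : α = Nat.gcd 32 c := by rw [gcd_thirtytwo_eq_gcd_eight h16]
  haveI : NeZero c'' := ⟨(Nat.div_pos (Nat.le_of_dvd hcpos (Nat.gcd_dvd_right 8 c)) hαpos).ne'⟩
  have hodd : Odd c'' := odd_div_gcd_eight h16
  have L8 := tendsto_thetaMul_div_prefactor hc (s := 8) (α := α) (δ := δ) (c'' := c'')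
    (by norm_num) hα h8 hcc
  have L32 := tendsto_thetaMul_div_prefactor hc (s := 32) (α := α) (δ := 4 * δ) (c'' := c'')
    (by norm_num) hα32 h32 hcc
  have key := (L32.const_mul 2).sub L8
  simp only [← mul_div_assoc, ← sub_div] at key
  convert key using 2
  -- the two limits agree
  have hG : quadGaussSum c'' (((g 0 0 : ℤ) * (4 * δ : ℕ) : ℤ) : ZMod c'') 0 =
      quadGaussSum c'' (((g 0 0 : ℤ) * δ : ℤ) : ZMod c'') 0 := by
    have e : (((g 0 0 : ℤ) * (4 * δ : ℕ) : ℤ) : ZMod c'') = 4 * (((g 0 0 : ℤ) * δ : ℤ) : ZMod c'') := by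
      push_cast; ring
    rw [e, quadGaussSum_four_mul_left hodd]
  have hδpos : 0 < δ := by
    rcases Nat.eq_zero_or_pos δ with h0 | h0
    · rw [h0, mul_zero] at h8; omega
    · exact h0
  have hm : 0 < c'' * δ := Nat.mul_pos (Nat.pos_of_ne_zero (NeZero.ne c'')) hδpos
  have hsqrt : Real.sqrt ((c'' * (4 * δ) : ℕ) : ℝ) = 2 * Real.sqrt ((c'' * δ : ℕ) : ℝ) := by
    rw [show ((c'' * (4 * δ) : ℕ) : ℝ) = 4 * ((c'' * δ : ℕ) : ℝ) by push_cast; ring,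
      Real.sqrt_mul (by norm_num : (0 : ℝ) ≤ 4), show (4 : ℝ) = 2 ^ 2 by norm_num,
      Real.sqrt_sq (by norm_num : (0 : ℝ) ≤ 2)]
  have hs0 : (Real.sqrt ((c'' * δ : ℕ) : ℝ) : ℂ) ≠ 0 := by
    have : (0 : ℝ) < (c'' * δ : ℕ) := by exact_mod_cast hm
    exact_mod_cast (Real.sqrt_pos.mpr this).ne'
  rw [hG, hsqrt]
  push_cast
  field_simp
  ring

/-- **`2g = (θ₁ - θ₄)(2θ₃₂ - θ₈)` vanishes at every cusp** `g · ∞`, `c > 0`: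
`[(θ₁ - θ₄)(gz)/P(z)] · [(2θ₃₂ - θ₈)(gz)/P(z)] → 0` as `Im z → ∞` (the first factor tends to `0`
when `16 ∣ c`, the second when `16 ∤ c`, and both have limits). This is the cusp-form property of
Tunnell's weight-`1` form `g` (Thm 1: `g ∈ S₁(128, χ₋₂)`), obtained here from the explicit theta
expansions. [cite: Tunnell1983Congruent, Thm 1 (p. 326)] -/
theorem tendsto_weightOneFactor {g : SL(2, ℤ)} (hc : (g 1 0 : ℤ) = c) :
    Tendsto (fun z : ℍ ↦ (thetaMul 1 (g • z) - thetaMul 4 (g • z)) /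
        (1 / (2 * I / ((c : ℂ) * z + g 1 1)) ^ (1 / 2 : ℂ)) *
      ((2 * thetaMul 32 (g • z) - thetaMul 8 (g • z)) /
        (1 / (2 * I / ((c : ℂ) * z + g 1 1)) ^ (1 / 2 : ℂ)))) atImInfty (𝓝 0) := by
  by_cases h16 : 16 ∣ c
  · obtain ⟨L32, hL32⟩ := exists_tendsto_thetaMul_div_prefactor hc (s := 32) (by norm_num)
    obtain ⟨L8, hL8⟩ := exists_tendsto_thetaMul_div_prefactor hc (s := 8) (by norm_num)
    have hB : Tendsto (fun z : ℍ ↦ (2 * thetaMul 32 (g • z) - thetaMul 8 (g • z)) /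
        (1 / (2 * I / ((c : ℂ) * z + g 1 1)) ^ (1 / 2 : ℂ))) atImInfty (𝓝 (2 * L32 - L8)) := by
      have := (hL32.const_mul 2).sub hL8
      simpa only [← mul_div_assoc, ← sub_div] using this
    simpa using (tendsto_thetaMul_one_sub_four hc h16).mul hB
  · obtain ⟨L1, hL1⟩ := exists_tendsto_thetaMul_div_prefactor hc (s := 1) one_pos
    obtain ⟨L4, hL4⟩ := exists_tendsto_thetaMul_div_prefactor hc (s := 4) (by norm_num)
    have hA : Tendsto (fun z : ℍ ↦ (thetaMul 1 (g • z) - thetaMul 4 (g • z)) /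
        (1 / (2 * I / ((c : ℂ) * z + g 1 1)) ^ (1 / 2 : ℂ))) atImInfty (𝓝 (L1 - L4)) := by
      have := hL1.sub hL4
      simpa only [← sub_div] using this
    simpa using hA.mul (tendsto_two_mul_thetaMul_thirtytwo_sub_eight hc h16)

/-- **`g θ_t` vanishes at the cusp `g · ∞` for `c > 0`** (`t ≥ 1`):
`(g θ_t)(gz)²/(cz + d)³ → 0` as `Im z → ∞`. With `P(z) = (2i/(cz + d))^{-1/2}`,
`(g θ_t)(gz)²/(cz + d)³ = ¼ (2i)⁻³ · ([(θ₁ - θ₄)/P][(2θ₃₂ - θ₈)/P][θ_t/P](gz))²`, and the bracket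
tends to `0 · lim θ_t(gz)/P(z) = 0`. [cite: Tunnell1983Congruent, p. 327] -/
theorem isZeroAtImInfty_slashSq_tunnellForm_of_pos {t : ℕ} (ht : 0 < t) {g : SL(2, ℤ)}
    (hc : (g 1 0 : ℤ) = c) : IsZeroAtImInfty (slashSq 3 (tunnellForm t) g) := by
  obtain ⟨Lt, hLt⟩ := exists_tendsto_thetaMul_div_prefactor hc (s := t) ht
  have hQ := (tendsto_weightOneFactor hc).mul hLt
  rw [zero_mul] at hQ
  have hK := (hQ.pow 2).const_mul ((1 / 4 : ℂ) * (1 / (2 * I)) ^ 3)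
  rw [zero_pow two_ne_zero, mul_zero] at hK
  show Tendsto (slashSq 3 (tunnellForm t) g) atImInfty (𝓝 0)
  refine hK.congr fun z ↦ ?_
  -- the algebraic identity
  set P : ℂ := 1 / (2 * I / ((c : ℂ) * z + g 1 1)) ^ (1 / 2 : ℂ) with hP
  have hP0 : P ≠ 0 := prefactor_ne_zero (c := c) (g 1 1) z
  have hw := im_denom_pos (c := c) (g 1 1) z
  have hw0 : (c : ℂ) * z + g 1 1 ≠ 0 := by
    intro h; rw [h] at hw; simp at hw
  have hsq : P ^ 2 / ((c : ℂ) * z + g 1 1) = 1 / (2 * I) := prefactor_sq_div (c := c) (g 1 1) z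
  have h2 := two_mul_tunnellForm_eq t (g • z)
  have hF : tunnellForm t (g • z) = (thetaMul 1 (g • z) - thetaMul 4 (g • z)) *
      (2 * thetaMul 32 (g • z) - thetaMul 8 (g • z)) * thetaMul t (g • z) / 2 := by
    linear_combination (1 / 2 : ℂ) * h2
  simp only [slashSq]
  rw [ModularGroup.denom_apply, hc, hF, ← hsq]
  push_cast
  field_simp
  ring

end Pos

/-! ### The remaining cusps: `c < 0` and `c = 0` -/

/-- `c < 0`: `slashSq 3 f g = - slashSq 3 f (-g)` (`(-g) z = g z`, `denom(-g) = -denom(g)`), and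
`-g` has positive lower-left entry. [folklore] -/
theorem isZeroAtImInfty_slashSq_tunnellForm_of_neg {t : ℕ} (ht : 0 < t) {g : SL(2, ℤ)}
    (hneg : (g 1 0 : ℤ) < 0) : IsZeroAtImInfty (slashSq 3 (tunnellForm t) g) := by
  set g' := -g with hg'
  have hc' : ((g' 1 0 : ℤ)) = ((g 1 0).natAbs : ℕ) := by
    rw [hg', SL_neg_apply, Int.ofNat_natAbs_of_nonpos hneg.le]
  haveI : NeZero (g 1 0 : ℤ).natAbs := ⟨Int.natAbs_ne_zero.mpr hneg.ne⟩
  have key := isZeroAtImInfty_slashSq_tunnellForm_of_pos ht hc'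
  have heq : slashSq 3 (tunnellForm t) g = -slashSq 3 (tunnellForm t) g' := by
    funext z
    simp only [slashSq, Pi.neg_def]
    rw [hg', ModularGroup.SL_neg_smul, ModularGroup.denom_apply, ModularGroup.denom_apply,
      SL_neg_apply, SL_neg_apply]
    push_cast
    have hX := sl_denom_ne_zero g z
    have e' : -((g 1 0 : ℤ) : ℂ) * z + -((g 1 1 : ℤ) : ℂ) = -(((g 1 0 : ℤ) : ℂ) * z + (g 1 1 : ℤ)) := by
      ring
    have hX' : -(((g 1 0 : ℤ) : ℂ) * z + (g 1 1 : ℤ)) ≠ 0 := neg_ne_zero.mpr hX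
    rw [e']
    field_simp
  rw [heq]
  have key' : Tendsto (slashSq 3 (tunnellForm t) g') atImInfty (𝓝 0) := key
  have := key'.neg
  rw [neg_zero] at this
  exact this

/-- `W = (1 0; 128 1) ∈ SL₂(ℤ)`. [folklore] -/
theorem exists_W128 : ∃ W : SL(2, ℤ), W 0 0 = 1 ∧ W 0 1 = 0 ∧ W 1 0 = 128 ∧ W 1 1 = 1 :=
  ⟨⟨!![1, 0; 128, 1], by norm_num [Matrix.det_fin_two_of]⟩, rfl, rfl, rfl, rfl⟩

/-- **`(g θ_t)² → 0` at `i∞`** (`4t ∣ 128`): by automorphy under `W = (1 0; 128 1)`,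
`(g θ_t)(Wz)² = j(W, z)⁶ (g θ_t)(z)² = (128 z + 1)³ (g θ_t)(z)²`, so
`(g θ_t)(z)² = slashSq 3 (g θ_t) W z → 0` by the case `c = 128 > 0`. [folklore] -/
theorem isZeroAtImInfty_tunnellForm_sq {t : ℕ} [NeZero t] (ht : (4 * t : ℤ) ∣ 128) :
    IsZeroAtImInfty (fun z : ℍ ↦ tunnellForm t z ^ 2) := by
  obtain ⟨W, h00, h01, h10, h11⟩ := exists_W128
  have hc : (W 1 0 : ℤ) = ((128 : ℕ) : ℤ) := by rw [h10]; rfl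
  have key := isZeroAtImInfty_slashSq_tunnellForm_of_pos (c := 128)
    (Nat.pos_of_ne_zero (NeZero.ne t)) hc
  have heq : (fun z : ℍ ↦ tunnellForm t z ^ 2) = slashSq 3 (tunnellForm t) W := by
    funext z
    simp only [slashSq]
    have h4t : (4 * t : ℤ) ∣ W 1 0 := by simpa only [h10] using ht
    rw [tunnellForm_smul (by rw [h10]) h4t z, ModularGroup.denom_apply, h10, h11]
    have hj : thetaFactor 128 1 z ^ 2 = (128 : ℂ) * z + 1 := by
      have := thetaFactor_sq (c := 128) (d := 1) (by decide) z
      simpa using this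
    have hw : (128 : ℂ) * z + 1 ≠ 0 := by
      have := im_denom_pos (c := 128) 1 z
      intro h; push_cast at this; rw [h] at this; simp at this
    rw [Int.natAbs_one, jacobiSym.one_right]
    push_cast
    rw [show ((1 : ℂ) * thetaFactor 128 1 z ^ 3 * tunnellForm t z) ^ 2 =
      (thetaFactor 128 1 z ^ 2) ^ 3 * tunnellForm t z ^ 2 by ring, hj]
    field_simp
  rw [heq]
  exact key

/-- `c = 0`: `g = ±(1 n; 0 1)`, `gz = z + n·(±1)`, `(g θ_t)(gz) = (g θ_t)(z)` and `denom = ±1`, so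
`slashSq 3 (g θ_t) g = ± (g θ_t)²`, which tends to `0`. [folklore] -/
theorem isZeroAtImInfty_slashSq_tunnellForm_of_zero {t : ℕ} [NeZero t] (ht : (4 * t : ℤ) ∣ 128)
    {g : SL(2, ℤ)} (hzero : (g 1 0 : ℤ) = 0) : IsZeroAtImInfty (slashSq 3 (tunnellForm t) g) := by
  have h1 := det_eq_one' g
  rw [hzero, mul_zero, sub_zero] at h1
  have hd : (g 1 1 : ℤ) ^ 3 = g 1 1 := by
    rcases Int.eq_one_or_neg_one_of_mul_eq_one' h1 with ⟨-, hd⟩ | ⟨-, hd⟩ <;> rw [hd] <;> norm_num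
  have heq : slashSq 3 (tunnellForm t) g = fun z : ℍ ↦ ((g 1 1 : ℤ) : ℂ) * tunnellForm t z ^ 2 := by
    funext z
    simp only [slashSq]
    rw [smul_eq_vadd_of_apply_one_zero_eq_zero hzero z, tunnellForm_vadd_intCast,
      ModularGroup.denom_apply, hzero]
    simp only [Int.cast_zero, zero_mul, zero_add]
    have hd' : ((g 1 1 : ℤ) : ℂ) ^ 3 = (g 1 1 : ℤ) := by exact_mod_cast hd
    have hd1 : ((g 1 1 : ℤ) : ℂ) * (g 1 1 : ℤ) = 1 := by
      rcases Int.eq_one_or_neg_one_of_mul_eq_one' h1 with ⟨-, h⟩ | ⟨-, h⟩ <;> rw [h] <;> norm_num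
    rw [hd', div_eq_iff (by intro h0; rw [h0, mul_zero] at hd1; exact zero_ne_one hd1)]
    linear_combination -(tunnellForm t z ^ 2) * hd1
  rw [heq]
  have h0 : Tendsto (fun z : ℍ ↦ tunnellForm t z ^ 2) atImInfty (𝓝 0) :=
    isZeroAtImInfty_tunnellForm_sq ht
  have := h0.const_mul ((g 1 1 : ℤ) : ℂ)
  rw [mul_zero] at this
  exact this

/-- **`g θ_t` vanishes at every cusp of `SL₂(ℤ)`** (`t ∣ 32`): for every `g ∈ SL₂(ℤ)`,
`(g θ_t)(gz)²/(cz + d)³ → 0` as `Im z → ∞` — the third membership condition of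
`halfIntCuspForms 3 128 χ`. [cite: Tunnell1983Congruent, p. 327, ll. 17–20] -/
theorem isZeroAtImInfty_slashSq_tunnellForm {t : ℕ} [NeZero t] (ht : (4 * t : ℤ) ∣ 128)
    (g : SL(2, ℤ)) : IsZeroAtImInfty (slashSq 3 (tunnellForm t) g) := by
  rcases lt_trichotomy (g 1 0 : ℤ) 0 with hneg | hzero | hpos
  · exact isZeroAtImInfty_slashSq_tunnellForm_of_neg (Nat.pos_of_ne_zero (NeZero.ne t)) hneg
  · exact isZeroAtImInfty_slashSq_tunnellForm_of_zero ht hzero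
  · haveI : NeZero (g 1 0 : ℤ).natAbs := ⟨Int.natAbs_ne_zero.mpr hpos.ne'⟩
    exact isZeroAtImInfty_slashSq_tunnellForm_of_pos (c := (g 1 0 : ℤ).natAbs)
      (Nat.pos_of_ne_zero (NeZero.ne t)) (Int.natAbs_of_nonneg hpos.le).symm

/-! ### Membership in `S_{3/2}(128, χ)` -/

/-- **`g θ₂ ∈ S_{3/2}(128, 1)`** — a cusp form of weight `3/2`, level `128` and trivial character
(Tunnell p. 327: "a basis for the space of cusp forms of weight `3/2`, level `128` and trivial
character is `{g θ₂, g θ₈, g θ₃₂}`"): holomorphy (`mdifferentiable_tunnellForm`), theta-automorphy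
(`isThetaAutomorphic_tunnellForm_two`) and vanishing at all cusps
(`isZeroAtImInfty_slashSq_tunnellForm`). [cite: Tunnell1983Congruent, p. 327, ll. 17–20] -/
theorem tunnellForm_two_mem_halfIntCuspForms : tunnellForm 2 ∈ halfIntCuspForms 3 128 1 :=
  ⟨mdifferentiable_tunnellForm (by norm_num), isThetaAutomorphic_tunnellForm_two,
    isZeroAtImInfty_slashSq_tunnellForm (by norm_num)⟩

/-- **`g θ₈ ∈ S_{3/2}(128, 1)`.** [cite: Tunnell1983Congruent, p. 327, ll. 17–20] -/
theorem tunnellForm_eight_mem_halfIntCuspForms : tunnellForm 8 ∈ halfIntCuspForms 3 128 1 :=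
  ⟨mdifferentiable_tunnellForm (by norm_num), isThetaAutomorphic_tunnellForm_eight,
    isZeroAtImInfty_slashSq_tunnellForm (by norm_num)⟩

/-- **`g θ₃₂ ∈ S_{3/2}(128, 1)`.** [cite: Tunnell1983Congruent, p. 327, ll. 17–20] -/
theorem tunnellForm_thirtytwo_mem_halfIntCuspForms : tunnellForm 32 ∈ halfIntCuspForms 3 128 1 :=
  ⟨mdifferentiable_tunnellForm (by norm_num), isThetaAutomorphic_tunnellForm_thirtytwo,
    isZeroAtImInfty_slashSq_tunnellForm (by norm_num)⟩

/-- **`g θ₁ ∈ S_{3/2}(128, χ₂)`** ("`{g θ₁, g θ₄, g θ₁₆}` is a basis for the weight `3/2` cusp forms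
of level `128` and character `χ₈`", p. 327). [cite: Tunnell1983Congruent, p. 327, ll. 17–20] -/
theorem tunnellForm_one_mem_halfIntCuspForms : tunnellForm 1 ∈ halfIntCuspForms 3 128 tunnellChar :=
  ⟨mdifferentiable_tunnellForm (by norm_num), isThetaAutomorphic_tunnellForm_one,
    isZeroAtImInfty_slashSq_tunnellForm (by norm_num)⟩

/-- **`g θ₄ ∈ S_{3/2}(128, χ₂)`.** [cite: Tunnell1983Congruent, p. 327, ll. 17–20] -/
theorem tunnellForm_four_mem_halfIntCuspForms : tunnellForm 4 ∈ halfIntCuspForms 3 128 tunnellChar :=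
  ⟨mdifferentiable_tunnellForm (by norm_num), isThetaAutomorphic_tunnellForm_four,
    isZeroAtImInfty_slashSq_tunnellForm (by norm_num)⟩

/-- **`g θ₁₆ ∈ S_{3/2}(128, χ₂)`.** [cite: Tunnell1983Congruent, p. 327, ll. 17–20] -/
theorem tunnellForm_sixteen_mem_halfIntCuspForms :
    tunnellForm 16 ∈ halfIntCuspForms 3 128 tunnellChar :=
  ⟨mdifferentiable_tunnellForm (by norm_num), isThetaAutomorphic_tunnellForm_sixteen,
    isZeroAtImInfty_slashSq_tunnellForm (by norm_num)⟩

/-! ### Consequences for Theorem 2 and for Waldspurger's theorem as applied on p. 329 -/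

/-- **Theorem 2 (trivial character) reduced to its Hecke half**: given the cuspidality just
proved, `Tunnell1983_thm2_triv` — membership of `g θ₂`, `g θ₈` in `S_{3/2}(128, 1, φ)` — is
EQUIVALENT to the statement that `g θ₂` and `g θ₈` are `T(p²)`-eigenforms with the eigenvalues
`a_p(E)` for almost all `p ∤ 128` (`IsAlmostEigenform`), which is the part of Theorem 2 resting on
the dimension formula `dim S_{3/2}(128, 1) = 3` [Cohen–Oesterlé], the stability of the space under
`T(p²)` [Shimura 1973, Thm 1.7] and Shimura's correspondence (pp. 327–328).
[cite: Tunnell1983Congruent, Thm 2 (pp. 327–328)] -/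
theorem Tunnell1983_thm2_triv_iff_isAlmostEigenform :
    Tunnell1983_thm2_triv ↔
      IsAlmostEigenform 3 128 1 tunnellEigenvalues (tunnellForm 2) ∧
        IsAlmostEigenform 3 128 1 tunnellEigenvalues (tunnellForm 8) := by
  unfold Tunnell1983_thm2_triv tunnellSubspace
  rw [mem_shimuraSubspace_iff, mem_shimuraSubspace_iff]
  exact ⟨fun h ↦ ⟨h.1.2, h.2.2⟩, fun h ↦ ⟨⟨tunnellForm_two_mem_halfIntCuspForms, h.1⟩,
    ⟨tunnellForm_eight_mem_halfIntCuspForms, h.2⟩⟩⟩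

/-- **Theorem 2 (character `χ₂`) reduced to its Hecke half**, likewise.
[cite: Tunnell1983Congruent, Thm 2 (pp. 327–328)] -/
theorem Tunnell1983_thm2_chi2_iff_isAlmostEigenform :
    Tunnell1983_thm2_chi2 ↔
      IsAlmostEigenform 3 128 tunnellChar tunnellEigenvalues (tunnellForm 4) ∧
        IsAlmostEigenform 3 128 tunnellChar tunnellEigenvalues (tunnellForm 16) := by
  unfold Tunnell1983_thm2_chi2 tunnellSubspace
  rw [mem_shimuraSubspace_iff, mem_shimuraSubspace_iff]
  exact ⟨fun h ↦ ⟨h.1.2, h.2.2⟩, fun h ↦ ⟨⟨tunnellForm_four_mem_halfIntCuspForms, h.1⟩,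
    ⟨tunnellForm_sixteen_mem_halfIntCuspForms, h.2⟩⟩⟩

/-- **`Tunnell1983_waldspurger_triv ↔ Tunnell1983_a_sq_propto_L_one`**: with (M) proved, the leaf
"Waldspurger's theorem as applied on p. 329" (trivial character) is exactly the two displays of
p. 329 (`Tunnell1983_waldspurger_triv_iff` of `TunnellHalfIntegralFormsProofs` with its first
conjunct discharged). [cite: Tunnell1983Congruent, proof of Thm 3, p. 329] -/
theorem Tunnell1983_waldspurger_triv_iff_propto :
    Tunnell1983_waldspurger_triv ↔ Tunnell1983_a_sq_propto_L_one := by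
  rw [Tunnell1983_waldspurger_triv_iff]
  exact ⟨fun h ↦ h.2, fun h ↦ ⟨⟨tunnellForm_two_mem_halfIntCuspForms,
    tunnellForm_eight_mem_halfIntCuspForms⟩, h⟩⟩

/-- **`Tunnell1983_waldspurger_chi2 ↔ Tunnell1983_b_sq_propto_L_one`**, likewise.
[cite: Tunnell1983Congruent, proof of Thm 3, p. 329] -/
theorem Tunnell1983_waldspurger_chi2_iff_propto :
    Tunnell1983_waldspurger_chi2 ↔ Tunnell1983_b_sq_propto_L_one := by
  rw [Tunnell1983_waldspurger_chi2_iff]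
  exact ⟨fun h ↦ h.2, fun h ↦ ⟨⟨tunnellForm_four_mem_halfIntCuspForms,
    tunnellForm_sixteen_mem_halfIntCuspForms⟩, h⟩⟩

end Literature.NumberTheory.EllipticCurves.Tunnell1983
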